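import Literature.Probability.LatticeModels.RandomClusterClosedCut
import Literature.Barriers.CriticalPhenomena.RandomClusterFirstOrderProofs
import HarnessLib

/-!
# FK-continuity cell, FO-10a: the influence of the boundary condition on an increasing event seen in a window is
# at most the probability that the window is joined to the wired set (finite graphs; Duminil-Copin 2019, Exercise 10)

Claimed R42 (8)(c) in the cell INBOX at 2026-08-28T10:00:12Z by fkp-10a gen 353 (NEW CLAIM #1 of the gen), under provision (ι) (no coordinator seated since gen 267's closing line l.8331: the lane lead absorbs the registry word, silence = consent; readers fk-ref / fkt-lead / fkp-18r / fkp-10b); lineage row FO-10a-g353 (self-suggested), package g353-weakmixing, label WM-A.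
Helper file of the `fk-continuity` build cell (bschramm lane; `--supports stmt-CriticalPhenomena-4575`); builds on
p205010 (kernel theorem, internal audit signed; external expert review pending). No definitions, no named facts, no
sorries; standard axioms. Finite-graph level, over the tree's `rcMeasure G p q B` (`RandomCluster.lean`).

Let `G` be a finite graph, `B` a wired vertex set, `W` a window (finite vertex set) and `A` an INCREASING event
determined by edges of `G` with both endpoints in `W`. Write `{W ↔ B}` for "some vertex of `W` is joined to some
vertex of `B` by an open path" and `{W ↮ B}` for its complement. The coupling-free argument of Duminil-Copin's
Exercise 10 (decompose along the random set `S` of vertices joined to `B`; on `{S = S₀}` the cut between `S₀` and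
its complement is CLOSED, so by the domain Markov property across a closed cut — the tree's
`rcMeasure_real_inter_eq_mul_of_closed_cut` — the configuration off `S₀` is a FREE random-cluster configuration of
the remaining graph, which is dominated by the free measure of `G` itself) gives, for `0 ≤ p ≤ 1`, `q ≥ 1`:

* `rcMeasure_real_inter_notJoined_le` — **`φ^B_G(A ∩ {W ↮ B}) ≤ φ^0_G(A) · φ^B_G(W ↮ B)`**
  (Exercise 10 (3): `φ^ξ_G[A | W ↮ ∂G] ≤ φ^0_G[A]`).
* `rcMeasure_real_sub_free_le_mul_joined`, `rcMeasure_real_sub_free_mem_Icc` —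
  **`0 ≤ φ^B_G(A) − φ^0_G(A) ≤ (1 − φ^0_G(A)) · φ^B_G(W ↔ B) ≤ φ^B_G(W ↔ B)`**: the influence of the wiring on `A` is at
  most the probability that the window feels the wiring at all.
* `abs_rcMeasure_real_sub_le_joined_of_subset` — two wired sets `B' ⊆ B`: `|φ^B_G(A) − φ^{B'}_G(A)| ≤ φ^B_G(W ↔ B)`;
  `abs_rcMeasure_real_sub_free_le_joined_of_isLowerSet` — the same bound for DECREASING events (complements).

On `ℤ^d` the right-hand side is a one-arm probability of the wired measure, exponentially small below `p_c(q)` (DRT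
sharpness): the finite-volume input of the weak-mixing files `BoundaryConditionInfluence{Zd,TV}`, `WeakMixingBelowCritical`.

## References

* H. Duminil-Copin, *Lectures on the Ising and Potts models on the hypercubic lattice*, Springer PROMS 304 (2019)
  35–161, §1.2, Exercise 10 (Comparison with boundary conditions 2). [DuminilCopin2019]
* G. Grimmett, *The Random-Cluster Model*, Springer 2006: Thm. (3.1)(a), Lemma (4.13), Lemma (4.14). [Grimmett2006]
* K. S. Alexander, *On weak mixing in lattice models*, PTRF 110 (1998) 441–471, §2 (2.7) and Thm. 3.4. [Alexander1998]
-/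

noncomputable section

open MeasureTheory

namespace Summit.CriticalPhenomena.PercolationContinuityZ3.Theorems.FK

open Literature.Probability.Percolation Literature.Probability.LatticeModels Literature.Barriers.CriticalPhenomena

namespace BoundaryInfluence

section General

variable {V : Type*}

/-- If `x` is joined to `B` and `s(x, u)` is an open edge then `u` is joined to `B`. [folklore] -/
theorem joined_of_adj {ω : BondConfig V} {B : Set V} {x u : V}
    (hx : ∃ b ∈ B, (openGraph ω).Reachable x b) (hxu : (openGraph ω).Adj x u) :
    ∃ b ∈ B, (openGraph ω).Reachable u b := by
  obtain ⟨b, hb, hxb⟩ := hx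
  exact ⟨b, hb, hxu.symm.reachable.trans hxb⟩

end General

/-! ### The random set of vertices joined to the wired set, and its level sets -/

variable {V : Type*} [Fintype V] [DecidableEq V] (G : SimpleGraph V) [DecidableRel G.Adj]

/-- The level sets `{S = S₀}` of the random set `S` of vertices joined to `B` (through open edges of `G`) are
determined by the edges of `G` touching `S₀` (Duminil-Copin 2019, Exercise 10 (1): "`{S = S}` is measurable in terms
of edges with at least one endpoint" in the joined set). [cite: DuminilCopin2019, §1.2 Exercise 10 (1)] -/
theorem levelSet_determined (B : Set V) (S₀ : Finset V) (ω₁ ω₂ : BondConfig V)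
    (h : ω₁ ∩ ↑(G.edgeFinset.filter fun e => ∃ v ∈ S₀, v ∈ e) =
      ω₂ ∩ ↑(G.edgeFinset.filter fun e => ∃ v ∈ S₀, v ∈ e))
    (h₁ : ∀ v, v ∈ S₀ ↔ ∃ b ∈ B, (openGraph (ω₁ ∩ G.edgeSet)).Reachable v b) :
    ∀ v, v ∈ S₀ ↔ ∃ b ∈ B, (openGraph (ω₂ ∩ G.edgeSet)).Reachable v b := by
  -- an open `G`-edge of `ωᵢ` with an endpoint in `S₀` is an open `G`-edge of `ωⱼ`
  have key : ∀ {ω ω' : BondConfig V}, ω ∩ ↑(G.edgeFinset.filter fun e => ∃ v ∈ S₀, v ∈ e) =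
      ω' ∩ ↑(G.edgeFinset.filter fun e => ∃ v ∈ S₀, v ∈ e) →
      ∀ {x u : V}, x ∈ S₀ → (openGraph (ω ∩ G.edgeSet)).Adj x u → (openGraph (ω' ∩ G.edgeSet)).Adj x u := by
    intro ω ω' hωω' x u hx hadj
    rw [openGraph_adj] at hadj ⊢
    have hmem : s(x, u) ∈ ω ∩ ↑(G.edgeFinset.filter fun e => ∃ v ∈ S₀, v ∈ e) := by
      refine ⟨hadj.1.1, ?_⟩
      rw [Finset.coe_filter, Set.mem_setOf_eq, SimpleGraph.mem_edgeFinset]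
      exact ⟨hadj.1.2, x, hx, Sym2.mem_mk_left x u⟩
    exact ⟨⟨(hωω' ▸ hmem).1, hadj.1.2⟩, hadj.2⟩
  intro v
  constructor
  · -- a path of `ω₁` from `v ∈ S₀` to `B` runs inside `S₀`, hence is a path of `ω₂`
    intro hv
    obtain ⟨b, hb, ⟨p⟩⟩ := (h₁ v).1 hv
    refine ⟨b, hb, ?_⟩
    suffices hmain : ∀ (x y : V) (p' : (openGraph (ω₁ ∩ G.edgeSet)).Walk x y), y ∈ B →
        (openGraph (ω₂ ∩ G.edgeSet)).Reachable x y from hmain v b p hb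
    intro x y p'
    induction p' with
    | nil => exact fun _ => SimpleGraph.Reachable.refl _
    | @cons x u y hadj p'' ih =>
      intro hy
      have hx : x ∈ S₀ := (h₁ x).2 ⟨y, hy, (SimpleGraph.Walk.cons hadj p'').reachable⟩
      exact (key h hx hadj).reachable.trans (ih hy)
  · -- a path of `ω₂` from `B ⊆ S₀` cannot leave `S₀`
    rintro ⟨b, hb, hvb⟩
    have hbS : b ∈ S₀ := (h₁ b).2 ⟨b, hb, SimpleGraph.Reachable.refl _⟩
    obtain ⟨p⟩ := hvb.symm
    suffices hmain : ∀ (x y : V) (p' : (openGraph (ω₂ ∩ G.edgeSet)).Walk x y), x ∈ S₀ → y ∈ S₀ from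
      hmain b v p hbS
    intro x y p'
    induction p' with
    | nil => exact id
    | @cons x u y hadj p'' ih =>
      intro hx
      have hadj₁ : (openGraph (ω₁ ∩ G.edgeSet)).Adj x u := key h.symm hx hadj
      exact ih ((h₁ u).2 (joined_of_adj ((h₁ x).1 hx) hadj₁))

/-- On `{S = S₀}` the cut between `S₀` and its complement is closed: an open edge of `G` touching `S₀` has both
endpoints in `S₀`. [cite: DuminilCopin2019, §1.2 Exercise 10 (2)] -/
theorem levelSet_closed_cut (B : Set V) (S₀ : Finset V) {ω : BondConfig V}
    (hω : ∀ v, v ∈ S₀ ↔ ∃ b ∈ B, (openGraph (ω ∩ G.edgeSet)).Reachable v b)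
    {e : Sym2 V} (he : e ∈ ω) (heT : e ∈ G.edgeFinset.filter fun e => ∃ v ∈ S₀, v ∈ e) :
    ∀ x ∈ e, x ∈ (↑S₀ : Set V) := by
  rw [Finset.mem_filter, SimpleGraph.mem_edgeFinset] at heT
  obtain ⟨heG, v, hv, hve⟩ := heT
  intro x hx
  by_cases hxv : x = v
  · rw [hxv]; exact hv
  · have hexv : e = s(v, x) := ((Sym2.mem_and_mem_iff (Ne.symm hxv)).1 ⟨hve, hx⟩)
    exact (hω x).2 (joined_of_adj ((hω v).1 hv)
      ((openGraph_adj _ v x).2 ⟨⟨hexv ▸ he, hexv ▸ heG⟩, Ne.symm hxv⟩))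


/-! ### The free measure of a spanning subgraph is dominated by the free measure of the graph -/

/-- The empty configuration has positive mass for `p < 1`, so an event containing it has positive probability.
[cite: Grimmett2006, §1.2 eq. (1.2)] -/
theorem rcMeasure_real_pos_of_empty_mem {p q : ℝ} (hp : p ∈ Set.Icc (0 : ℝ) 1) (hp1 : p < 1) (hq : 0 < q)
    (B : Set V) {A : Set (BondConfig V)} (hA : (∅ : BondConfig V) ∈ A) : 0 < (rcMeasure G p q B).real A := by
  classical
  haveI := isProbabilityMeasure_rcMeasure G hp hq B
  have hZ := rcPartitionFunction_pos G hp hq B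
  have hempty : (rcMeasure G p q B).real {(∅ : BondConfig V)} = rcWeight G p q B ∅ / rcPartitionFunction G p q B := by
    rw [rcMeasure_real_apply G hp hq B, Finset.sum_eq_single_of_mem ∅ (Finset.empty_mem_powerset _) fun ω _ hω ↦ ?_]
    · simp
    · rw [if_neg]
      rwa [Set.mem_singleton_iff, Finset.coe_eq_empty]
  have hpos : 0 < (rcMeasure G p q B).real {(∅ : BondConfig V)} := by
    rw [hempty]
    refine div_pos ?_ hZ
    have : 0 < 1 - p := sub_pos.2 hp1
    rw [rcWeight, Finset.card_empty, pow_zero, one_mul]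
    positivity
  exact hpos.trans_le (measureReal_mono (fun ω hω => (Set.mem_singleton_iff.1 hω) ▸ hA) (measure_ne_top _ _))

/-- **The free measure of a spanning subgraph is dominated by the free measure of the whole graph** on increasing
events: `φ^0_{⟨U⟩,p,q}(A) ≤ φ^0_{G,p,q}(A)` for `U ⊆ E(G)`, `0 ≤ p ≤ 1`, `q ≥ 1` (free measures increase with the
graph: Grimmett's (4.24) for an arbitrary edge set; from the closed-outside domain Markov property and FKG, the tree's
`rcMeasure_fromEdgeSet_real_le`; the degenerate `p = 1` case by hand). [cite: Grimmett2006, Thm. (3.1)(a), Lemma (4.14) and (4.24)] -/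
theorem rcMeasure_fromEdgeSet_free_real_le {p q : ℝ} (hp : p ∈ Set.Icc (0 : ℝ) 1) (hq : 1 ≤ q)
    (U : Finset (Sym2 V)) (hU : U ⊆ G.edgeFinset) {A : Set (BondConfig V)} (hA : IsUpperSet A) :
    (rcMeasure (SimpleGraph.fromEdgeSet (U : Set (Sym2 V))) p q ∅).real A ≤ (rcMeasure G p q ∅).real A := by
  classical
  have hq0 : 0 < q := one_pos.trans_le hq
  haveI := isProbabilityMeasure_rcMeasure G hp hq0 (∅ : Set V)
  haveI := isProbabilityMeasure_rcMeasure (SimpleGraph.fromEdgeSet (U : Set (Sym2 V))) hp hq0 (∅ : Set V)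
  rcases lt_or_eq_of_le hp.2 with hp1 | hp1
  · -- `p < 1`: closed-outside domain Markov property and FKG
    have h0 : 0 < (rcMeasure G p q ∅).real {ω | ω ∩ (↑U : Set (Sym2 V))ᶜ = ∅} :=
      rcMeasure_real_pos_of_empty_mem G hp hp1 hq0 ∅ (by simp)
    refine (rcMeasure_fromEdgeSet_real_le G hp hq ∅ U hU h0 hA).trans ?_
    exact measureReal_mono (fun ω hω => hA Set.inter_subset_left hω) (measure_ne_top _ _)
  · -- `p = 1`: both measures are the point mass at "every edge open"
    subst hp1
    by_cases hUA : ((SimpleGraph.fromEdgeSet (U : Set (Sym2 V))).edgeSet : BondConfig V) ∈ A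
    · have hGA : (G.edgeSet : BondConfig V) ∈ A := by
        refine hA (fun e he => ?_) hUA
        rw [SimpleGraph.edgeSet_fromEdgeSet] at he
        exact SimpleGraph.mem_edgeFinset.1 (hU he.1)
      rw [rcMeasure_real_one_left G hq0 ∅ A hGA]
      exact measureReal_le_one
    · have h1 := rcMeasure_real_one_left (SimpleGraph.fromEdgeSet (U : Set (Sym2 V))) hq0 ∅ Aᶜ hUA
      rw [probReal_compl_eq_one_sub MeasurableSet.of_discrete] at h1
      linarith [measureReal_nonneg (μ := rcMeasure G 1 q ∅) (s := A)]

/-! ### Duminil-Copin's Exercise 10: `φ^B_G(A ∩ {W ↮ B}) ≤ φ^0_G(A) · φ^B_G(W ↮ B)` -/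

/-- The one-level-set step (Exercise 10 (2)): for `S₀` disjoint from the window `W`,
`φ^B_G(A ∩ {S = S₀}) ≤ φ^B_G({S = S₀}) · φ^0_G(A)` — the closed-cut Markov property makes the configuration off `S₀`
a free configuration of the remaining graph, dominated by `φ^0_G`. [cite: DuminilCopin2019, §1.2 Exercise 10 (2)] -/
theorem rcMeasure_real_inter_levelSet_le {p q : ℝ} (hp : p ∈ Set.Icc (0 : ℝ) 1) (hq : 1 ≤ q) (B : Set V)
    (W S₀ : Finset V) (hWS : Disjoint W S₀) {F : Set (Sym2 V)} (hF : ∀ e ∈ F, e ∈ G.edgeSet ∧ ∀ x ∈ e, x ∈ W)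
    {A : Set (BondConfig V)} (hA : IsUpperSet A) (hAF : DeterminedBy A F) :
    (rcMeasure G p q B).real ({ω | ∀ v, v ∈ S₀ ↔ ∃ b ∈ B, (openGraph (ω ∩ G.edgeSet)).Reachable v b} ∩ A) ≤
      (rcMeasure G p q B).real {ω | ∀ v, v ∈ S₀ ↔ ∃ b ∈ B, (openGraph (ω ∩ G.edgeSet)).Reachable v b} *
        (rcMeasure G p q ∅).real A := by
  classical
  have hq0 : 0 < q := one_pos.trans_le hq
  set L : Set (BondConfig V) := {ω | ∀ v, v ∈ S₀ ↔ ∃ b ∈ B, (openGraph (ω ∩ G.edgeSet)).Reachable v b} with hL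
  by_cases hBS : B ⊆ ↑S₀
  swap
  · -- `B ⊄ S₀`: the level set is empty
    have hLe : L = ∅ := by
      refine Set.eq_empty_of_forall_notMem fun ω hω => hBS fun b hb => ?_
      exact Finset.mem_coe.2 ((hω b).2 ⟨b, hb, SimpleGraph.Reachable.refl _⟩)
    rw [hLe, Set.empty_inter, measureReal_empty, zero_mul]
  -- the closed cut at `S₀`
  set T : Finset (Sym2 V) := G.edgeFinset.filter fun e => ∃ v ∈ S₀, v ∈ e with hT
  have hTiff : ∀ e, e ∈ T ↔ e ∈ G.edgeFinset ∧ ∃ v ∈ (↑S₀ : Set V), v ∈ e := by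
    intro e; rw [hT, Finset.mem_filter]; simp only [Finset.mem_coe]
  have hLdet : ∀ ω₁ ω₂ : BondConfig V, ω₁ ∩ ↑T = ω₂ ∩ ↑T → (ω₁ ∈ L ↔ ω₂ ∈ L) := fun ω₁ ω₂ h =>
    ⟨levelSet_determined G B S₀ ω₁ ω₂ h, levelSet_determined G B S₀ ω₂ ω₁ h.symm⟩
  -- `A` is determined by the edges off `T`
  have hFT : F ⊆ ↑(G.edgeFinset \ T) := by
    intro e he
    obtain ⟨heG, heW⟩ := hF e he
    rw [Finset.coe_sdiff, Set.mem_sdiff, Finset.mem_coe, SimpleGraph.mem_edgeFinset, Finset.mem_coe, hT,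
      Finset.mem_filter]
    refine ⟨heG, fun ⟨_, v, hv, hve⟩ => ?_⟩
    exact Finset.disjoint_left.1 hWS (heW v hve) hv
  have hAdet : ∀ ω₁ ω₂ : BondConfig V, ω₁ ∩ ↑(G.edgeFinset \ T) = ω₂ ∩ ↑(G.edgeFinset \ T) → (ω₁ ∈ A ↔ ω₂ ∈ A) :=
    (determinedBy_iff A _).1 (hAF.mono hFT)
  have hcut := rcMeasure_real_inter_eq_mul_of_closed_cut G hp hq0 B (↑S₀) T hTiff L hLdet
    (fun ω hω e he heT => levelSet_closed_cut G B S₀ hω he heT) A hAdet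
  rw [hcut, Set.sdiff_eq_empty.2 hBS]
  refine mul_le_mul_of_nonneg_left ?_ measureReal_nonneg
  exact rcMeasure_fromEdgeSet_free_real_le G hp hq _ Finset.sdiff_subset hA

omit [DecidableRel G.Adj] in
/-- The level sets of `S` partition `{W ↮ B}` according to the (window-avoiding) value of `S`:
`μ(X ∩ {W ↮ B}) = Σ_{S₀ ∩ W = ∅} μ({S = S₀} ∩ X)` for every finite measure `μ` and every event `X`.
[cite: DuminilCopin2019, §1.2 Exercise 10 (2)–(3)] -/
theorem real_inter_notJoined_eq_sum (μ : Measure (BondConfig V)) [IsFiniteMeasure μ] (B : Set V) (W : Finset V)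
    (X : Set (BondConfig V)) :
    μ.real (X ∩ {ω | ∀ x ∈ W, ∀ b ∈ B, ¬ (openGraph (ω ∩ G.edgeSet)).Reachable x b}) =
      ∑ S₀ ∈ Finset.univ.filter (fun S₀ : Finset V => ∀ x ∈ W, x ∉ S₀),
        μ.real ({ω | ∀ v, v ∈ S₀ ↔ ∃ b ∈ B, (openGraph (ω ∩ G.edgeSet)).Reachable v b} ∩ X) := by
  classical
  rw [← measureReal_biUnion_finset]
  · congr 1
    ext ω
    simp only [Set.mem_inter_iff, Set.mem_setOf_eq, Set.mem_iUnion, Finset.mem_filter, Finset.mem_univ, true_and,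
      exists_prop]
    constructor
    · rintro ⟨hX, hN⟩
      refine ⟨Finset.univ.filter fun v => ∃ b ∈ B, (openGraph (ω ∩ G.edgeSet)).Reachable v b, ?_, ?_, hX⟩
      · intro x hx hxS
        rw [Finset.mem_filter] at hxS
        obtain ⟨b, hb, hxb⟩ := hxS.2
        exact hN x hx b hb hxb
      · intro v
        rw [Finset.mem_filter]
        simp only [Finset.mem_univ, true_and]
    · rintro ⟨S₀, hWS, hL, hX⟩
      exact ⟨hX, fun x hx b hb hxb => hWS x hx ((hL x).2 ⟨b, hb, hxb⟩)⟩
  · intro S₀ _ S₀' _ hne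
    refine Set.disjoint_left.2 fun ω hω hω' => hne ?_
    ext v
    exact (hω.1 v).trans (hω'.1 v).symm
  · exact fun _ _ => MeasurableSet.of_discrete

/-- **Duminil-Copin's Exercise 10 (3)**, for configurations read through the edges of `G`:
`φ^B_G(A ∩ {W ↮ B}) ≤ φ^0_G(A) · φ^B_G(W ↮ B)` for `A` increasing and determined by edges of `G` inside the window
`W` (`0 ≤ p ≤ 1`, `q ≥ 1`, any wired set `B`). Here "joined" is through open edges OF `G`
(`openGraph (ω ∩ E(G))`); see `rcMeasure_real_inter_notJoined_le` for the plain form.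
[cite: DuminilCopin2019, §1.2 Exercise 10 (3)] -/
theorem rcMeasure_real_inter_notJoined_le' {p q : ℝ} (hp : p ∈ Set.Icc (0 : ℝ) 1) (hq : 1 ≤ q) (B : Set V)
    (W : Finset V) {F : Set (Sym2 V)} (hF : ∀ e ∈ F, e ∈ G.edgeSet ∧ ∀ x ∈ e, x ∈ W)
    {A : Set (BondConfig V)} (hA : IsUpperSet A) (hAF : DeterminedBy A F) :
    (rcMeasure G p q B).real (A ∩ {ω | ∀ x ∈ W, ∀ b ∈ B, ¬ (openGraph (ω ∩ G.edgeSet)).Reachable x b}) ≤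
      (rcMeasure G p q ∅).real A *
        (rcMeasure G p q B).real {ω | ∀ x ∈ W, ∀ b ∈ B, ¬ (openGraph (ω ∩ G.edgeSet)).Reachable x b} := by
  classical
  have hq0 : 0 < q := one_pos.trans_le hq
  haveI := isProbabilityMeasure_rcMeasure G hp hq0 B
  have huniv := real_inter_notJoined_eq_sum G (rcMeasure G p q B) B W Set.univ
  rw [Set.univ_inter] at huniv
  rw [real_inter_notJoined_eq_sum G (rcMeasure G p q B) B W A, huniv, Finset.mul_sum]
  refine Finset.sum_le_sum fun S₀ hS₀ => ?_
  rw [Set.inter_univ, mul_comm]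
  exact rcMeasure_real_inter_levelSet_le G hp hq B W S₀
    (Finset.disjoint_left.2 fun x hx hxS => (Finset.mem_filter.1 hS₀).2 x hx hxS) hF hA hAF

/-! ### Plain forms: configurations are almost surely edge sets of `G` -/

omit [Fintype V] [DecidableEq V] [DecidableRel G.Adj] in
/-- For `ω ⊆ E(G)` the open graph "through edges of `G`" is the open graph. [folklore] -/
theorem openGraph_inter_edgeSet_eq {ω : BondConfig V} (hω : ω ⊆ G.edgeSet) : openGraph (ω ∩ G.edgeSet) = openGraph ω := by
  rw [Set.inter_eq_left.2 hω]

/-- **Duminil-Copin's Exercise 10 (3): `φ^B_G(A ∩ {W ↮ B}) ≤ φ^0_G(A) · φ^B_G(W ↮ B)`** — conditionally on the window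
`W` not being joined to the wired set `B`, an increasing event determined inside `W` is at most as likely as under the
FREE measure of `G` (`0 ≤ p ≤ 1`, `q ≥ 1`, any wired set `B`; `A` increasing, determined by a set `F` of edges of `G`
with both endpoints in `W`). [cite: DuminilCopin2019, §1.2 Exercise 10 (3)] -/
theorem rcMeasure_real_inter_notJoined_le {p q : ℝ} (hp : p ∈ Set.Icc (0 : ℝ) 1) (hq : 1 ≤ q) (B : Set V)
    (W : Finset V) {F : Set (Sym2 V)} (hF : ∀ e ∈ F, e ∈ G.edgeSet ∧ ∀ x ∈ e, x ∈ W)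
    {A : Set (BondConfig V)} (hA : IsUpperSet A) (hAF : DeterminedBy A F) :
    (rcMeasure G p q B).real (A ∩ {ω | ∀ x ∈ W, ∀ b ∈ B, ¬ (openGraph ω).Reachable x b}) ≤
      (rcMeasure G p q ∅).real A * (rcMeasure G p q B).real {ω | ∀ x ∈ W, ∀ b ∈ B, ¬ (openGraph ω).Reachable x b} := by
  have hq0 : 0 < q := one_pos.trans_le hq
  -- the measure lives on edge sets of `G` (the tree's `rcMeasure_real_mono_on_edgeSets`, both ways)
  have h1 : (rcMeasure G p q B).real (A ∩ {ω | ∀ x ∈ W, ∀ b ∈ B, ¬ (openGraph ω).Reachable x b}) =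
      (rcMeasure G p q B).real (A ∩ {ω | ∀ x ∈ W, ∀ b ∈ B, ¬ (openGraph (ω ∩ G.edgeSet)).Reachable x b}) :=
    le_antisymm
      (rcMeasure_real_mono_on_edgeSets G hp hq0 B fun ω hω h => by
        simpa only [Set.mem_inter_iff, Set.mem_setOf_eq, openGraph_inter_edgeSet_eq G hω] using h)
      (rcMeasure_real_mono_on_edgeSets G hp hq0 B fun ω hω h => by
        simpa only [Set.mem_inter_iff, Set.mem_setOf_eq, openGraph_inter_edgeSet_eq G hω] using h)
  have h2 : (rcMeasure G p q B).real {ω | ∀ x ∈ W, ∀ b ∈ B, ¬ (openGraph ω).Reachable x b} =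
      (rcMeasure G p q B).real {ω | ∀ x ∈ W, ∀ b ∈ B, ¬ (openGraph (ω ∩ G.edgeSet)).Reachable x b} :=
    le_antisymm
      (rcMeasure_real_mono_on_edgeSets G hp hq0 B fun ω hω h => by
        simpa only [Set.mem_setOf_eq, openGraph_inter_edgeSet_eq G hω] using h)
      (rcMeasure_real_mono_on_edgeSets G hp hq0 B fun ω hω h => by
        simpa only [Set.mem_setOf_eq, openGraph_inter_edgeSet_eq G hω] using h)
  rw [h1, h2]
  exact rcMeasure_real_inter_notJoined_le' G hp hq B W hF hA hAF

/-! ### Consequences: the influence of the boundary condition -/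

/-- **The influence of the wiring: `φ^B_G(A) − φ^0_G(A) ≤ (1 − φ^0_G(A)) · φ^B_G(W ↔ B)`** for `A` increasing,
determined inside the window `W` (`0 ≤ p ≤ 1`, `q ≥ 1`). [cite: DuminilCopin2019, §1.2 Exercise 10 (3); Alexander1998, §2 (2.7) and Thm. 3.4 (proof)] -/
theorem rcMeasure_real_sub_free_le_mul_joined {p q : ℝ} (hp : p ∈ Set.Icc (0 : ℝ) 1) (hq : 1 ≤ q) (B : Set V)
    (W : Finset V) {F : Set (Sym2 V)} (hF : ∀ e ∈ F, e ∈ G.edgeSet ∧ ∀ x ∈ e, x ∈ W)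
    {A : Set (BondConfig V)} (hA : IsUpperSet A) (hAF : DeterminedBy A F) :
    (rcMeasure G p q B).real A - (rcMeasure G p q ∅).real A ≤
      (1 - (rcMeasure G p q ∅).real A) * (rcMeasure G p q B).real {ω | ∃ x ∈ W, ∃ b ∈ B, (openGraph ω).Reachable x b} := by
  have hq0 : 0 < q := one_pos.trans_le hq
  haveI := isProbabilityMeasure_rcMeasure G hp hq0 B
  have hsplit := measureReal_inter_add_sdiff (μ := rcMeasure G p q B) (s := A)
    (t := {ω : BondConfig V | ∀ x ∈ W, ∀ b ∈ B, ¬ (openGraph ω).Reachable x b}) MeasurableSet.of_discrete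
  have hcompl : {ω : BondConfig V | ∀ x ∈ W, ∀ b ∈ B, ¬ (openGraph ω).Reachable x b}ᶜ =
      {ω | ∃ x ∈ W, ∃ b ∈ B, (openGraph ω).Reachable x b} := by
    ext ω; simp only [Set.mem_compl_iff, Set.mem_setOf_eq, not_forall, not_not, exists_prop]
  have hN : (rcMeasure G p q B).real {ω : BondConfig V | ∀ x ∈ W, ∀ b ∈ B, ¬ (openGraph ω).Reachable x b} =
      1 - (rcMeasure G p q B).real {ω | ∃ x ∈ W, ∃ b ∈ B, (openGraph ω).Reachable x b} := by
    rw [← hcompl, probReal_compl_eq_one_sub MeasurableSet.of_discrete]; ring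
  have hdiff : (rcMeasure G p q B).real (A \ {ω : BondConfig V | ∀ x ∈ W, ∀ b ∈ B, ¬ (openGraph ω).Reachable x b}) ≤
      (rcMeasure G p q B).real {ω | ∃ x ∈ W, ∃ b ∈ B, (openGraph ω).Reachable x b} := by
    rw [← hcompl]
    exact measureReal_mono (fun ω hω => hω.2) (measure_ne_top _ _)
  have hle := rcMeasure_real_inter_notJoined_le G hp hq B W hF hA hAF
  rw [hN] at hle
  rw [← hsplit]
  nlinarith [measureReal_nonneg (μ := rcMeasure G p q ∅) (s := A)]

/-- **`0 ≤ φ^B_G(A) − φ^0_G(A) ≤ φ^B_G(W ↔ B)`**: the boundary condition changes the probability of an increasing event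
seen in the window `W` by at most the probability that `W` is joined to the wired set.
[cite: DuminilCopin2019, §1.2 Exercise 10 (3); Grimmett2006, Lemma (4.14)(b)] -/
theorem rcMeasure_real_sub_free_mem_Icc {p q : ℝ} (hp : p ∈ Set.Icc (0 : ℝ) 1) (hq : 1 ≤ q) (B : Set V)
    (W : Finset V) {F : Set (Sym2 V)} (hF : ∀ e ∈ F, e ∈ G.edgeSet ∧ ∀ x ∈ e, x ∈ W)
    {A : Set (BondConfig V)} (hA : IsUpperSet A) (hAF : DeterminedBy A F) :
    (rcMeasure G p q B).real A - (rcMeasure G p q ∅).real A ∈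
      Set.Icc 0 ((rcMeasure G p q B).real {ω | ∃ x ∈ W, ∃ b ∈ B, (openGraph ω).Reachable x b}) := by
  refine ⟨sub_nonneg.2 (rcMeasure_real_mono_wired_of_isUpperSet G hp hq (Set.empty_subset B) hA), ?_⟩
  refine (rcMeasure_real_sub_free_le_mul_joined G hp hq B W hF hA hAF).trans ?_
  have h0 : 0 ≤ (rcMeasure G p q ∅).real A := measureReal_nonneg
  have h1 : 0 ≤ (rcMeasure G p q B).real {ω | ∃ x ∈ W, ∃ b ∈ B, (openGraph ω).Reachable x b} := measureReal_nonneg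
  nlinarith

/-- **Two wired sets `B' ⊆ B`: `|φ^B_G(A) − φ^{B'}_G(A)| ≤ φ^B_G(W ↔ B)`** for `A` increasing, determined inside
`W` (both lie in `[φ^0_G(A), φ^B_G(A)]`). [cite: DuminilCopin2019, §1.2 Exercises 9–10; Grimmett2006, Lemma (4.14)(b)] -/
theorem abs_rcMeasure_real_sub_le_joined_of_subset {p q : ℝ} (hp : p ∈ Set.Icc (0 : ℝ) 1) (hq : 1 ≤ q)
    {B B' : Set V} (hB'B : B' ⊆ B) (W : Finset V) {F : Set (Sym2 V)} (hF : ∀ e ∈ F, e ∈ G.edgeSet ∧ ∀ x ∈ e, x ∈ W)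
    {A : Set (BondConfig V)} (hA : IsUpperSet A) (hAF : DeterminedBy A F) :
    |(rcMeasure G p q B).real A - (rcMeasure G p q B').real A| ≤
      (rcMeasure G p q B).real {ω | ∃ x ∈ W, ∃ b ∈ B, (openGraph ω).Reachable x b} := by
  have hmono := rcMeasure_real_mono_wired_of_isUpperSet G hp hq hB'B hA
  have hlow := rcMeasure_real_mono_wired_of_isUpperSet G hp hq (Set.empty_subset B') hA
  have hup := (rcMeasure_real_sub_free_mem_Icc G hp hq B W hF hA hAF).2
  rw [abs_of_nonneg (sub_nonneg.2 hmono)]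
  linarith

/-- **Decreasing events: `|φ^B_G(D) − φ^0_G(D)| ≤ φ^B_G(W ↔ B)`** for `D` decreasing, determined inside `W` (apply the
increasing case to the complement). [cite: DuminilCopin2019, §1.2 Exercise 10 (3); Grimmett2006, Lemma (4.14)(b)] -/
theorem abs_rcMeasure_real_sub_free_le_joined_of_isLowerSet {p q : ℝ} (hp : p ∈ Set.Icc (0 : ℝ) 1) (hq : 1 ≤ q)
    (B : Set V) (W : Finset V) {F : Set (Sym2 V)} (hF : ∀ e ∈ F, e ∈ G.edgeSet ∧ ∀ x ∈ e, x ∈ W)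
    {D : Set (BondConfig V)} (hD : IsLowerSet D) (hDF : DeterminedBy D F) :
    |(rcMeasure G p q B).real D - (rcMeasure G p q ∅).real D| ≤
      (rcMeasure G p q B).real {ω | ∃ x ∈ W, ∃ b ∈ B, (openGraph ω).Reachable x b} := by
  have hq0 : 0 < q := one_pos.trans_le hq
  haveI := isProbabilityMeasure_rcMeasure G hp hq0 B
  haveI := isProbabilityMeasure_rcMeasure G hp hq0 (∅ : Set V)
  have hDc : IsUpperSet Dᶜ := hD.compl
  have hDcF : DeterminedBy Dᶜ F :=
    (determinedBy_iff _ F).2 fun ω₁ ω₂ h => not_congr ((determinedBy_iff D F).1 hDF ω₁ ω₂ h)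
  have h := rcMeasure_real_sub_free_mem_Icc G hp hq B W hF hDc hDcF
  rw [probReal_compl_eq_one_sub MeasurableSet.of_discrete, probReal_compl_eq_one_sub MeasurableSet.of_discrete] at h
  rw [abs_le]
  constructor <;> linarith [h.1, h.2]

end BoundaryInfluence

end Summit.CriticalPhenomena.PercolationContinuityZ3.Theorems.FK

end
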